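import Summits.CriticalPhenomena.PercolationContinuityZ3.Theorems.PercThresholdOneFragileWeavingGiantExistsMeasure

/-!
# `FragileWeavingGiantExists` (stmt-CriticalPhenomena-5266) — measurability of the tree, lattice symmetries and the witness measure

Part of the proof of support item `FragileWeavingGiantExists` of route `PercThresholdOne` by the stationary
hierarchical spanning tree of `ℤ³` (see `PercThresholdOneFragileWeavingGiantExistsDefs.lean` for the construction and the overview).
-/

noncomputable section

namespace Summit.CriticalPhenomena.PercolationContinuityZ3.Theorems.FragileGiant

open MeasureTheory
open scoped ENNReal
open Literature.Probability.Percolation Literature.Probability.LatticeModels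
open Literature.Probability.Percolation.DCT16

/-- The jump level is measurable. -/
theorem measurable_jlev (x : V3) : Measurable fun ω : Ω => jlev ω x := by
  classical
  let p : Ω → ℕ → Prop := fun ω m =>
    digit ω x m ≠ pos (exitType ω x (m + 1)) ∨ ¬∃ m, digit ω x m ≠ pos (exitType ω x (m + 1))
  have hp : ∀ ω, ∃ m, p ω m := fun ω => by
    by_cases h : ∃ m, digit ω x m ≠ pos (exitType ω x (m + 1))
    · obtain ⟨m, hm⟩ := h; exact ⟨m, Or.inl hm⟩
    · exact ⟨0, Or.inr h⟩
  have hbasic : ∀ m, MeasurableSet {ω : Ω | digit ω x m ≠ pos (exitType ω x (m + 1))} := fun m =>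
    measurableSet_digit_exitType x m (m + 1) fun a t => a ≠ pos t
  have hE : MeasurableSet {ω : Ω | ∃ m, digit ω x m ≠ pos (exitType ω x (m + 1))} := by
    rw [Set.setOf_exists]; exact MeasurableSet.iUnion hbasic
  have hm : ∀ k, MeasurableSet {ω | p ω k} := fun k => (hbasic k).union hE.compl
  have key : (fun ω => jlev ω x) = fun ω => Nat.find (hp ω) := by
    funext ω
    unfold jlev
    by_cases h : ∃ m, digit ω x m ≠ pos (exitType ω x (m + 1))
    · rw [dif_pos h]
      have hiff : ∀ j, p ω j ↔ digit ω x j ≠ pos (exitType ω x (j + 1)) := fun j =>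
        ⟨fun hj => hj.resolve_right (not_not.2 h), Or.inl⟩
      apply le_antisymm
      · exact Nat.find_min' h ((hiff _).1 (Nat.find_spec (hp ω)))
      · exact Nat.find_min' (hp ω) ((hiff _).2 (Nat.find_spec h))
    · rw [dif_neg h]
      symm
      rw [Nat.find_eq_zero]
      exact Or.inr h
  rw [key]
  exact measurable_find hp hm

/-- Level sets of the parent direction are measurable. -/
theorem measurableSet_parDir_eq (x : V3) (d : Dir) : MeasurableSet {ω : Ω | parDir ω x = d} := by
  have : {ω : Ω | parDir ω x = d} =
      ⋃ j : ℕ, {ω | jlev ω x = j} ∩ {ω | qstep (digit ω x j) (exitType ω x (j + 1)) = d} := by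
    ext ω
    simp only [Set.mem_setOf_eq, Set.mem_iUnion, Set.mem_inter_iff, parDir]
    constructor
    · intro h; exact ⟨_, rfl, h⟩
    · rintro ⟨j, rfl, h⟩; exact h
  rw [this]
  exact MeasurableSet.iUnion fun j => ((measurable_jlev x) (measurableSet_singleton j)).inter
    (measurableSet_digit_exitType x j (j + 1) fun a t => qstep a t = d)

/-- The parent is a measurable function of the randomness. -/
theorem measurable_par (x : V3) : Measurable fun ω : Ω => par ω x := by
  refine measurable_to_countable' fun y => ?_
  have : (fun ω : Ω => par ω x) ⁻¹' {y} = ⋃ d : Dir, ⋃ (_ : x + unitVec d = y), {ω | parDir ω x = d} := by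
    ext ω
    simp only [Set.mem_preimage, Set.mem_singleton_iff, Set.mem_iUnion, Set.mem_setOf_eq, par, exists_prop]
    constructor
    · intro h; exact ⟨_, h, rfl⟩
    · rintro ⟨d, h, hd⟩; rw [hd]; exact h
  rw [this]
  exact MeasurableSet.iUnion fun d => MeasurableSet.iUnion fun _ => measurableSet_parDir_eq x d

/-- **The tree is a measurable function of the randomness.** -/
theorem measurable_treeConfig : Measurable treeConfig := by
  rw [measurable_set_iff]
  intro e
  refine measurableSet_setOf.1 ?_
  have : {ω : Ω | e ∈ treeConfig ω} = ⋃ x : V3, (fun ω => par ω x) ⁻¹' {y | s(x, y) = e} := by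
    ext ω; simp [mem_treeConfig_iff]
  rw [this]
  exact MeasurableSet.iUnion fun x => (measurable_par x) (Set.to_countable _).measurableSet

/-- Membership in a relabelled configuration. -/
theorem mem_relab_iff (h : V3 → V3) (ξ : Set (Sym2 V3)) (e : Sym2 V3) : e ∈ relab h ξ ↔ Sym2.map h e ∈ ξ :=
  Iff.rfl

/-- Relabelling is measurable. -/
theorem measurable_relab (h : V3 → V3) : Measurable (relab h) :=
  measurable_set_iff.2 fun e => measurable_set_mem (Sym2.map h e)

/-- Composition of relabellings (contravariant). -/
theorem relab_relab (g h : V3 → V3) (ξ : Set (Sym2 V3)) : relab g (relab h ξ) = relab (h ∘ g) ξ := by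
  ext e; simp [relab, Sym2.map_map]

/-- Composition of relabellings as functions. -/
theorem relab_comp (g h : V3 → V3) : relab g ∘ relab h = relab (h ∘ g) := funext (relab_relab g h)

/-- The trivial relabelling. -/
theorem relab_id (ξ : Set (Sym2 V3)) : relab id ξ = ξ := by ext e; simp [relab]

/-- Relabelling commutes with intersections. -/
theorem relab_inter (h : V3 → V3) (ξ ζ : Set (Sym2 V3)) : relab h (ξ ∩ ζ) = relab h ξ ∩ relab h ζ := rfl

/-- For a bijection, `relab φ` is the tree's relabelling along `φ⁻¹`. -/
theorem relab_eq_relabel (φ : V3 ≃ V3) (ξ : Set (Sym2 V3)) :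
    relab φ ξ = BondConfig.relabel (sym2Equiv φ.symm) ξ := by
  ext e
  rw [mem_relab_iff, BondConfig.mem_relabel_iff, sym2Equiv_symm, Equiv.symm_symm, sym2Equiv_apply]

/-- A bijective relabelling and its inverse cancel. -/
theorem relab_symm_relab (φ : V3 ≃ V3) (ξ : Set (Sym2 V3)) : relab φ.symm (relab φ ξ) = ξ := by
  rw [relab_relab, φ.self_comp_symm]; exact relab_id ξ

/-- A bijective relabelling and its inverse cancel. -/
theorem relab_relab_symm (φ : V3 ≃ V3) (ξ : Set (Sym2 V3)) : relab φ (relab φ.symm ξ) = ξ := by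
  rw [relab_relab, φ.symm_comp_self]; exact relab_id ξ

/-- The open graph of a relabelled configuration, for an injective map. -/
theorem openGraph_relab_adj {φ : V3 → V3} (hφ : Function.Injective φ) (ξ : Set (Sym2 V3)) (a b : V3) :
    (openGraph (relab φ ξ)).Adj a b ↔ (openGraph ξ).Adj (φ a) (φ b) := by
  rw [openGraph_adj, openGraph_adj, mem_relab_iff, Sym2.map_mk, hφ.ne_iff]

/-- Paths transport along a bijective relabelling. -/
theorem pathIn_relab_iff (φ : V3 ≃ V3) (ξ : Set (Sym2 V3)) (A : Set V3) (x y : V3) :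
    PathIn (openGraph (relab φ ξ)) A x y ↔ PathIn (openGraph ξ) (φ '' A) (φ x) (φ y) := by
  constructor
  · intro h
    exact pathIn_map φ (fun a ha => Set.mem_image_of_mem _ ha)
      (fun a b _ _ hab => (openGraph_relab_adj φ.injective ξ a b).1 hab) h
  · intro h
    have := pathIn_map φ.symm (B := A) (fun a ha => by
        obtain ⟨a', ha', rfl⟩ := ha; rwa [φ.symm_apply_apply])
      (fun a b _ _ hab => (openGraph_relab_adj φ.injective ξ (φ.symm a) (φ.symm b)).2
        (by rwa [φ.apply_symm_apply, φ.apply_symm_apply])) h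
    rwa [φ.symm_apply_apply, φ.symm_apply_apply] at this

/-- Restricted connection events transport along a bijective relabelling. -/
theorem relab_mem_openConnIn_iff (φ : V3 ≃ V3) (ξ : Set (Sym2 V3)) (A : Set V3) (x y : V3) :
    relab φ ξ ∈ openConnIn A x y ↔ ξ ∈ openConnIn (φ '' A) (φ x) (φ y) := by
  rw [mem_openConnIn_iff_pathIn, mem_openConnIn_iff_pathIn, pathIn_relab_iff]

/-- Reachability transports along an injective relabelling. -/
theorem reachable_relab_iff (φ : V3 ≃ V3) (ξ : Set (Sym2 V3)) (x y : V3) :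
    (openGraph (relab φ ξ)).Reachable x y ↔ (openGraph ξ).Reachable (φ x) (φ y) := by
  have h1 : ∀ (ψ : V3 ≃ V3) (ζ : Set (Sym2 V3)) (a b : V3), (openGraph (relab ψ ζ)).Reachable a b →
      (openGraph ζ).Reachable (ψ a) (ψ b) := by
    intro ψ ζ a b h
    let f : openGraph (relab ψ ζ) →g openGraph ζ :=
      { toFun := ψ, map_rel' := fun {a b} hab => (openGraph_relab_adj ψ.injective ζ a b).1 hab }
    exact h.map f
  refine ⟨h1 φ ξ x y, fun h => ?_⟩
  have := h1 φ.symm (relab φ ξ) (φ x) (φ y) (by rwa [relab_symm_relab])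
  rwa [φ.symm_apply_apply, φ.symm_apply_apply] at this

/-- A lattice automorphism relabels lattice configurations to lattice configurations. -/
theorem relab_subset_edgeSet (g : SP) {ξ : Set (Sym2 V3)} (hξ : ξ ⊆ (zdGraph 3).edgeSet) :
    relab (spEquiv g) ξ ⊆ (zdGraph 3).edgeSet := by
  intro e he
  rw [mem_relab_iff] at he
  have := hξ he
  rwa [show Sym2.map (spEquiv g) e = sym2Equiv (zdSignedPermIso g.1 g.2).toEquiv e from rfl,
    sym2Equiv_mem_edgeSet_iff] at this

/-- The composition law is correct. -/
theorem spEquiv_spComp (g₀ g : SP) : (spEquiv (spComp g₀ g) : V3 → V3) = spEquiv g ∘ spEquiv g₀ := by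
  funext x i
  simp [spEquiv, spComp, mul_assoc]

/-- The parametrisation of signed permutations by `SP` is injective. -/
theorem spEquiv_injective : Function.Injective fun g : SP => (spEquiv g : V3 → V3) := by
  intro g g' h
  simp only at h
  have key : ∀ i, g.1.symm i = g'.1.symm i ∧ (g.2 i : ℤ) = g'.2 i := by
    intro i
    have h1 := congr_fun (congr_fun h (Pi.single (g.1.symm i) 1)) i
    simp only [spEquiv, Site.signedPerm_apply, Pi.single_eq_same, mul_one] at h1
    by_cases hi : g'.1.symm i = g.1.symm i
    · rw [hi, Pi.single_eq_same, mul_one] at h1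
      exact ⟨hi.symm, h1⟩
    · rw [Pi.single_eq_of_ne hi, mul_zero] at h1
      exact absurd h1 (Units.ne_zero _)
  have h1 : g.1 = g'.1 := by
    have : g.1.symm = g'.1.symm := Equiv.ext fun i => (key i).1
    simpa using congr_arg Equiv.symm this
  refine Prod.ext h1 (funext fun i => Units.ext (key i).2)

/-- Right composition by a fixed signed permutation is a bijection of `SP`. -/
theorem spComp_bijective (g₀ : SP) : Function.Bijective (spComp g₀) := by
  refine (Finite.injective_iff_bijective).1 fun g g' h => ?_
  have h1 : (spEquiv g : V3 → V3) ∘ spEquiv g₀ = spEquiv g' ∘ spEquiv g₀ := by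
    rw [← spEquiv_spComp, ← spEquiv_spComp, h]
  apply spEquiv_injective
  funext x
  have := congr_fun h1 ((spEquiv g₀).symm x)
  simpa using this

/-- Pushing forward a finite sum of measures. -/
theorem map_finset_sum {α β : Type*} [MeasurableSpace α] [MeasurableSpace β] {ι : Type*} (s : Finset ι)
    (m : ι → Measure α) {f : α → β} (hf : Measurable f) :
    (∑ i ∈ s, m i).map f = ∑ i ∈ s, (m i).map f := by
  classical
  induction s using Finset.induction_on with
  | empty => simp
  | insert a s ha ih => rw [Finset.sum_insert ha, Finset.sum_insert ha, Measure.map_add _ _ hf, ih]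

/-- **Translation invariance of the law of the tree.** -/
theorem ν0_map_relab_add (v : V3) : ν0.map (relab (· + v)) = ν0 := by
  rw [ν0, Measure.map_map (measurable_relab _) measurable_treeConfig]
  have : relab (· + v) ∘ treeConfig = treeConfig ∘ addω v := by
    funext ω; exact (treeConfig_addω v ω).symm
  rw [this, ← Measure.map_map measurable_treeConfig (measurable_addω v), map_addω]

/-- **Invariance of the witness measure under signed permutations.** -/
theorem νsym_map_relab_spEquiv (g₀ : SP) : νsym.map (relab (spEquiv g₀)) = νsym := by
  rw [νsym, Measure.map_smul, map_finset_sum _ _ (measurable_relab _)]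
  congr 1
  simp_rw [Measure.map_map (measurable_relab _) (measurable_relab _), relab_comp, ← spEquiv_spComp]
  exact Equiv.sum_comp (Equiv.ofBijective _ (spComp_bijective g₀)) (fun g => ν0.map (relab (spEquiv g)))

/-- **Invariance of the witness measure under translations.** -/
theorem νsym_map_relab_add (v : V3) : νsym.map (relab (· + v)) = νsym := by
  rw [νsym, Measure.map_smul, map_finset_sum _ _ (measurable_relab _)]
  congr 1
  refine Finset.sum_congr rfl fun g _ => ?_
  rw [Measure.map_map (measurable_relab _) (measurable_relab _), relab_comp]
  have hcomm : (spEquiv g : V3 → V3) ∘ (· + v) = (· + spEquiv g v) ∘ spEquiv g := by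
    funext x; simp [spEquiv, Site.signedPerm_add]
  rw [hcomm, ← relab_comp, ← Measure.map_map (measurable_relab _) (measurable_relab _), ν0_map_relab_add]

/-- `νsym` is a probability measure. (A theorem rather than an instance: its proof needs the
measurability of the tree.) -/
theorem isProbabilityMeasure_νsym : IsProbabilityMeasure νsym := by
  constructor
  rw [νsym, Measure.smul_apply, Measure.coe_finsetSum, Finset.sum_apply]
  have : ∀ g : SP, (ν0.map (relab (spEquiv g))) Set.univ = 1 := fun g => by
    rw [Measure.map_apply (measurable_relab _) MeasurableSet.univ, Set.preimage_univ, ν0,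
      Measure.map_apply measurable_treeConfig MeasurableSet.univ, Set.preimage_univ, measure_univ]
  simp only [this, Finset.sum_const, Finset.card_univ, nsmul_eq_mul, mul_one, smul_eq_mul]
  exact ENNReal.inv_mul_cancel (by simp) (ENNReal.natCast_ne_top _)

/-- The three kinds of maps listed in the route statement are translations or signed permutations. -/
theorem relab_eq_of_listed {g : V3 → V3}
    (hg : (∃ a, g = (· + a)) ∨ (∃ σ : Equiv.Perm (Fin 3), g = fun x j => x (σ j)) ∨
      g = fun x => Function.update x 0 (-x 0)) :
    (∃ a : V3, g = (· + a)) ∨ ∃ g₀ : SP, g = spEquiv g₀ := by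
  rcases hg with h | ⟨σ, rfl⟩ | rfl
  · exact Or.inl h
  · refine Or.inr ⟨(σ.symm, 1), ?_⟩
    funext x j; simp [spEquiv]
  · refine Or.inr ⟨(1, fun i => if i = 0 then -1 else 1), ?_⟩
    funext x j
    by_cases hj : j = 0
    · subst hj; simp [spEquiv, ← Equiv.Perm.inv_def]
    · simp [spEquiv, hj, ← Equiv.Perm.inv_def]

/-- **Invariance of the witness measure under every listed map.** -/
theorem νsym_invariant (g : V3 → V3)
    (hg : (∃ a, g = (· + a)) ∨ (∃ σ : Equiv.Perm (Fin 3), g = fun x j => x (σ j)) ∨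
      g = fun x => Function.update x 0 (-x 0))
    (A : Set (Set (Sym2 V3))) (hA : MeasurableSet A) :
    νsym ((fun ξ => Sym2.map g ⁻¹' ξ) ⁻¹' A) = νsym A := by
  have hmap : νsym.map (relab g) = νsym := by
    rcases relab_eq_of_listed hg with ⟨a, rfl⟩ | ⟨g₀, rfl⟩
    · exact νsym_map_relab_add a
    · exact νsym_map_relab_spEquiv g₀
  conv_rhs => rw [← hmap]
  rw [Measure.map_apply (measurable_relab g) hA]
  rfl

/-- The image of a coordinate half-space under a signed permutation is a coordinate half-space. -/
theorem image_spEquiv_halfSpace_ge (g : SP) (i : Fin 3) (k : ℤ) :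
    (spEquiv g '' {z : V3 | k ≤ z i} = {w | k ≤ w (g.1 i)}) ∨ (spEquiv g '' {z : V3 | k ≤ z i} = {w | w (g.1 i) ≤ -k}) := by
  rw [Equiv.image_eq_preimage_symm]
  rcases Int.units_eq_one_or (g.2 (g.1 i)) with h | h
  · left; ext w; simp [spEquiv, h]
  · right; ext w; simp [spEquiv, h]; omega

/-- The image of a coordinate half-space under a signed permutation is a coordinate half-space. -/
theorem image_spEquiv_halfSpace_le (g : SP) (i : Fin 3) (k : ℤ) :
    (spEquiv g '' {z : V3 | z i ≤ k} = {w | w (g.1 i) ≤ k}) ∨ (spEquiv g '' {z : V3 | z i ≤ k} = {w | -k ≤ w (g.1 i)}) := by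
  rw [Equiv.image_eq_preimage_symm]
  rcases Int.units_eq_one_or (g.2 (g.1 i)) with h | h
  · left; ext w; simp [spEquiv, h]
  · right; ext w; simp [spEquiv, h]; omega

/-- **The relabelled tree of a good randomness is a good configuration.** -/
theorem goodConfig_relab_treeConfig (ω : Ω) (hω : ω ∈ goodSet) (g : SP) :
    relab (spEquiv g) (treeConfig ω) ∈ goodConfigs := by
  refine ⟨relab_subset_edgeSet g (treeConfig_subset_edgeSet ω), fun x y _ _ => ?_, fun i k x => ⟨?_, ?_⟩⟩
  · show (openGraph (relab (spEquiv g) (treeConfig ω))).Reachable x y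
    rw [reachable_relab_iff]
    exact reachable_treeConfig ω hω _ _
  · have hset : {y | relab (spEquiv g) (treeConfig ω) ∈ openConnIn {z : V3 | k ≤ z i} x y} =
        spEquiv g ⁻¹' {y' | treeConfig ω ∈ openConnIn (spEquiv g '' {z : V3 | k ≤ z i}) (spEquiv g x) y'} := by
      ext y; simp only [Set.mem_setOf_eq, Set.mem_preimage, relab_mem_openConnIn_iff]
    rw [hset]
    refine Set.Finite.preimage (Set.injOn_of_injective (spEquiv g).injective) ?_
    rcases image_spEquiv_halfSpace_ge g i k with h | h <;> rw [h]
    · exact finite_cluster_halfSpace_ge ω hω subset_rfl _ _ _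
    · exact finite_cluster_halfSpace_le ω hω subset_rfl _ _ _
  · have hset : {y | relab (spEquiv g) (treeConfig ω) ∈ openConnIn {z : V3 | z i ≤ k} x y} =
        spEquiv g ⁻¹' {y' | treeConfig ω ∈ openConnIn (spEquiv g '' {z : V3 | z i ≤ k}) (spEquiv g x) y'} := by
      ext y; simp only [Set.mem_setOf_eq, Set.mem_preimage, relab_mem_openConnIn_iff]
    rw [hset]
    refine Set.Finite.preimage (Set.injOn_of_injective (spEquiv g).injective) ?_
    rcases image_spEquiv_halfSpace_le g i k with h | h <;> rw [h]
    · exact finite_cluster_halfSpace_le ω hω subset_rfl _ _ _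
    · exact finite_cluster_halfSpace_ge ω hω subset_rfl _ _ _

/-- The set of good configurations is measurable. -/
theorem measurableSet_goodConfigs : MeasurableSet goodConfigs := by
  have h1 : Measurable fun ξ : Set (Sym2 V3) => ξ ⊆ (zdGraph 3).edgeSet :=
    Measurable.forall fun e => (measurable_set_mem e).imp measurable_const
  have hperc : ∀ x : V3, Measurable fun ξ : Set (Sym2 V3) => (openCluster ξ x).Infinite := fun x =>
    measurableSet_setOf.1 (measurableSet_percolatesAt_holds x)
  have hconn : ∀ x y : V3, Measurable fun ξ : Set (Sym2 V3) => y ∈ openCluster ξ x := fun x y =>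
    measurableSet_setOf.1 (measurableSet_openConn_holds x y)
  have h2 : Measurable fun ξ : Set (Sym2 V3) =>
      ∀ x y, (openCluster ξ x).Infinite → (openCluster ξ y).Infinite → y ∈ openCluster ξ x :=
    Measurable.forall fun x => Measurable.forall fun y => (hperc x).imp ((hperc y).imp (hconn x y))
  have hfin : ∀ (A : Set V3) (x : V3), Measurable fun ξ : Set (Sym2 V3) => {y | ξ ∈ openConnIn A x y}.Finite := by
    intro A x
    have : (fun ξ : Set (Sym2 V3) => {y | ξ ∈ openConnIn A x y}.Finite) =
        fun ξ => ∃ F : Finset V3, ∀ y, ξ ∈ openConnIn A x y → y ∈ F := by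
      funext ξ
      apply propext
      constructor
      · intro h; exact ⟨h.toFinset, fun y hy => h.mem_toFinset.2 hy⟩
      · rintro ⟨F, hF⟩; exact F.finite_toSet.subset fun y hy => hF y hy
    rw [this]
    exact Measurable.exists fun F => Measurable.forall fun y =>
      (measurableSet_setOf.1 (measurableSet_openConnIn_of_countable A x y)).imp measurable_const
  have h3 : Measurable fun ξ : Set (Sym2 V3) => ∀ (i : Fin 3) (k : ℤ) (x : V3),
      {y | ξ ∈ openConnIn {z | k ≤ z i} x y}.Finite ∧ {y | ξ ∈ openConnIn {z | z i ≤ k} x y}.Finite :=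
    Measurable.forall fun i => Measurable.forall fun k => Measurable.forall fun x =>
      (hfin _ x).and (hfin _ x)
  exact measurableSet_setOf.2 (h1.and (h2.and h3))

/-- Almost sure statements for `νsym` from statements about relabelled trees. -/
theorem ae_νsym_of_forall {Q : Set (Sym2 V3) → Prop} (hQ : MeasurableSet {ξ | Q ξ})
    (h : ∀ ω ∈ goodSet, ∀ g : SP, Q (relab (spEquiv g) (treeConfig ω))) : ∀ᵐ ξ ∂νsym, Q ξ := by
  rw [νsym]
  refine Measure.ae_smul_measure ?_ _
  rw [ae_iff, Measure.coe_finsetSum, Finset.sum_apply, Finset.sum_eq_zero_iff]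
  intro g _
  rw [ν0, Measure.map_map (measurable_relab _) measurable_treeConfig, ← ae_iff,
    ae_map_iff ((measurable_relab _).comp measurable_treeConfig).aemeasurable hQ]
  filter_upwards [ae_mem_goodSet] with ω hω
  exact h ω hω g

/-- **Almost surely the witness is a nearest-neighbour, uniquely percolating, weaving configuration.** -/
theorem ae_goodConfigs : ∀ᵐ ξ ∂νsym, ξ ∈ goodConfigs :=
  ae_νsym_of_forall measurableSet_goodConfigs goodConfig_relab_treeConfig

end Summit.CriticalPhenomena.PercolationContinuityZ3.Theorems.FragileGiant
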